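import Summits.NavierStokesRegularity.NavierStokesRegularity.Theses.AxisymmetricExtremality
import Summits.NavierStokesRegularity.NavierStokesRegularity.Theorems.AxisymmetricExtremalityAxisymmetricKatoGlobalNoSwirlStratum

/-!
# Strategist s20-g13 (family `s`, independent census) — typed companion of `STRATEGY-CENSUS-s20.md`

Crux `AxisymmetricExtremality.AxisymmetricKatoGlobal` (AX_H, stmt-NavierStokesRegularity-15453).
Nothing here is a claim on the crux.  Kernel-checked bookkeeping for the census:

* `NoAxisymMinimalBlowupDatum` (W0) — the WEAKEST statement that can replace AX_H in the route's
  deciding theorem `closes` (AX_H is used there only at the axisymmetric Rusin–Šverák minimal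
  blow-up datum produced by `PFoldToAxisymmetric ∘ MinimalDatumPFold`):
  `closes_of_noAxisymMinimalBlowupDatum` (same logic as `closes`) and
  `noAxisymMinimalBlowupDatum_of_crux` (AX_H ⇒ W0).
* `noAxisymMinimalBlowupDatum_noSwirl_stratum` — W0's swirl-free stratum is a THEOREM (landed
  `hasGlobalKatoSolution_of_isAxisymmetric_hasNoSwirl_viscosity`).
* `hasNoSwirl_of_isAxisymmetric_of_isReflSymmetric` — an axisymmetric field that is ALSO
  equivariant under the reflection in one vertical plane (hence O(2)-equivariant) has no swirl
  (`Γ` is a pseudoscalar).  Consequence `closes_of_dihedral`: if the route's symmetric-minimal-datum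
  crux were re-glued to DIHEDRAL symmetry (`MinimalDatumDihedral`, `DihedralToO2` below — route
  level, NOT items, recorded for the tenure planner), the analytic crux AX_H disappears entirely:
  the deciding theorem closes on landed theorems.  (This concentrates the summit in the
  equivariant-minimal-datum crux; it is not a strategy short of the summit — see the census.)
* `AbsSmallSwirlKatoGlobal` — the typed "absolute small swirl" rung discussed (and rejected as a
  decomposition piece) in the census, § Decomposition (c).
-/

noncomputable section

-- single-conjunct summit: `Summit.<Summit>.<Problem>` repeats the name by the D-0017 layout
set_option linter.dupNamespace false

open MeasureTheory Set Function
open Literature.Analysis.FluidPDE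

namespace Summit.NavierStokesRegularity.NavierStokesRegularity.Cruxes.AxisymmetricKatoGlobal.StrategistS20g13

open Summit.NavierStokesRegularity.NavierStokesRegularity.Theses.AxisymmetricExtremality
open Summit.NavierStokesRegularity.NavierStokesRegularity.Theorems.AxisymmetricKatoGlobal.NoSwirlStratum

/-! ## W0 — the weakest replacement of AX_H in `closes` -/

/-- **W0.** For every `ν > 0` there is NO axisymmetric Rusin–Šverák minimal blow-up datum
(`IsMinimalBlowupDatum ν u₀ g ∧ IsAxisymmetric u₀` is contradictory). -/
def NoAxisymMinimalBlowupDatum : Prop :=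
  ∀ ν : ℝ, 0 < ν → ∀ (u₀ : EuclideanSpace ℝ (Fin 3) → EuclideanSpace ℝ (Fin 3))
    (g : Literature.Analysis.FunctionSpaces.HomSobolev (EuclideanSpace ℝ (Fin 3))
      (EuclideanSpace ℂ (Fin 3)) (1 / 2 : ℝ)),
    IsMinimalBlowupDatum ν u₀ g → IsAxisymmetric u₀ → False

/-- AX_H ⇒ W0 (W0 is the instance of AX_H at minimal blow-up data). -/
theorem noAxisymMinimalBlowupDatum_of_crux (h : AxisymmetricKatoGlobal) :
    NoAxisymMinimalBlowupDatum := by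
  intro ν hν u₀ g hmin hax
  obtain ⟨hL3, hrep, hdiv, -, hnot⟩ := hmin
  exact hnot (h ν hν u₀ g hL3 hrep hdiv (fun θ x => hax θ x))

/-- The route's deciding theorem with AX_H replaced by W0 (same two lines of logic as `closes`):
W0 is exactly what `closes` consumes of AX_H. -/
theorem closes_of_noAxisymMinimalBlowupDatum (h₂ : MinimalDatumPFold) (h₄ : PFoldToAxisymmetric)
    (h₀ : NoAxisymMinimalBlowupDatum) : NavierStokesRegularity := by
  show Literature.NS.NavierStokesExistenceSmoothR3
  intro ν hν u₀ hsm hdiv hdec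
  by_contra hno
  obtain ⟨u₁, g, hmin, hax⟩ := h₄ ν hν (h₂ ν hν ⟨u₀, hsm, hdiv, hdec, hno⟩)
  exact h₀ ν hν u₁ g hmin (fun θ x => hax θ x)

/-- W0's swirl-free stratum is a theorem (landed no-swirl `L³`/Kato theorem, every `ν > 0`). -/
theorem noAxisymMinimalBlowupDatum_noSwirl_stratum :
    ∀ ν : ℝ, 0 < ν → ∀ (u₀ : EuclideanSpace ℝ (Fin 3) → EuclideanSpace ℝ (Fin 3))
      (g : Literature.Analysis.FunctionSpaces.HomSobolev (EuclideanSpace ℝ (Fin 3))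
        (EuclideanSpace ℂ (Fin 3)) (1 / 2 : ℝ)),
      IsMinimalBlowupDatum ν u₀ g → IsAxisymmetric u₀ → HasNoSwirl u₀ → False := by
  intro ν hν u₀ g hmin hax hsw
  obtain ⟨hL3, -, hdiv, -, hnot⟩ := hmin
  exact hnot (hasGlobalKatoSolution_of_isAxisymmetric_hasNoSwirl_viscosity hν hL3 hdiv hax hsw)

/-! ## O(2)-equivariance kills the swirl (route-level observation, typed) -/

/-- Reflection in the vertical plane `{x 1 = 0}`: `(x₀, x₁, x₂) ↦ (x₀, -x₁, x₂)`. -/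
def reflY (x : EuclideanSpace ℝ (Fin 3)) : EuclideanSpace ℝ (Fin 3) :=
  WithLp.toLp 2 ![x 0, -x 1, x 2]

@[simp] theorem reflY_apply_zero (x : EuclideanSpace ℝ (Fin 3)) : reflY x 0 = x 0 := rfl
@[simp] theorem reflY_apply_one (x : EuclideanSpace ℝ (Fin 3)) : reflY x 1 = -x 1 := rfl
@[simp] theorem reflY_apply_two (x : EuclideanSpace ℝ (Fin 3)) : reflY x 2 = x 2 := rfl

/-- Equivariance under the reflection `reflY` (a velocity field is a vector: `u (σ x) = σ (u x)`). -/
def IsReflSymmetric (u : EuclideanSpace ℝ (Fin 3) → EuclideanSpace ℝ (Fin 3)) : Prop :=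
  ∀ x, u (reflY x) = reflY (u x)

/-- **An axisymmetric, reflection-equivariant field has no swirl.**  Rotate `x` into the plane
`{x 1 = 0}` (angle `-arg (x₀ + i x₁)`); there the reflection fixes the point, so the `x 1`-component
of `u` vanishes; by rotation equivariance that component is `Γ(x)/r`. -/
theorem hasNoSwirl_of_isAxisymmetric_of_isReflSymmetric
    {u : EuclideanSpace ℝ (Fin 3) → EuclideanSpace ℝ (Fin 3)}
    (hax : IsAxisymmetric u) (hσ : IsReflSymmetric u) : HasNoSwirl u := by
  intro x
  by_cases h0 : x 0 = 0 ∧ x 1 = 0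
  · simp [swirl, h0.1, h0.2]
  · -- the horizontal part of `x` as a nonzero complex number
    set z : ℂ := Complex.mk (x 0) (x 1) with hz
    have hz0 : z ≠ 0 := by
      intro h
      apply h0
      exact ⟨by simpa [hz] using congrArg Complex.re h, by simpa [hz] using congrArg Complex.im h⟩
    have hn : ‖z‖ ≠ 0 := norm_ne_zero_iff.mpr hz0
    set θ : ℝ := Complex.arg z with hθ
    have hc : Real.cos θ = x 0 / ‖z‖ := by simpa [hz] using Complex.cos_arg hz0
    have hs : Real.sin θ = x 1 / ‖z‖ := by simpa [hz] using Complex.sin_arg z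
    -- `y := R_{-θ} x` lies in the plane `{x 1 = 0}`
    have hy1 : rotZ (-θ) x 1 = 0 := by
      simp only [rotZ_apply_one, Real.sin_neg, Real.cos_neg, hc, hs]
      ring
    -- hence the reflection fixes `y`
    have hfix : reflY (rotZ (-θ) x) = rotZ (-θ) x := by
      ext i
      fin_cases i
      · rfl
      · simp [hy1]
      · rfl
    -- so the `x 1`-component of `u y` vanishes
    have h1 : u (rotZ (-θ) x) 1 = 0 := by
      have h := congrArg (fun v => v 1) (hσ (rotZ (-θ) x))
      simp only [hfix, reflY_apply_one] at h
      linarith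
    -- rotate back: that component is `(-x₁ u₀ + x₀ u₁)/‖z‖`
    rw [hax (-θ) x] at h1
    simp only [rotZ_apply_one, Real.sin_neg, Real.cos_neg, hc, hs] at h1
    have h2 : swirl u x / ‖z‖ = 0 := by
      rw [← h1, swirl]
      ring
    exact (div_eq_zero_iff.mp h2).resolve_right hn

/-- O(2)-equivariant (axisymmetric + one vertical reflection) minimal blow-up data do not exist —
a THEOREM (no-swirl stratum). -/
theorem no_O2_minimalBlowupDatum :
    ∀ ν : ℝ, 0 < ν → ∀ (u₀ : EuclideanSpace ℝ (Fin 3) → EuclideanSpace ℝ (Fin 3))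
      (g : Literature.Analysis.FunctionSpaces.HomSobolev (EuclideanSpace ℝ (Fin 3))
        (EuclideanSpace ℂ (Fin 3)) (1 / 2 : ℝ)),
      IsMinimalBlowupDatum ν u₀ g → IsAxisymmetric u₀ → IsReflSymmetric u₀ → False :=
  fun ν hν u₀ g hmin hax hσ =>
    noAxisymMinimalBlowupDatum_noSwirl_stratum ν hν u₀ g hmin hax
      (hasNoSwirl_of_isAxisymmetric_of_isReflSymmetric hax hσ)

/-- ROUTE-LEVEL SUGGESTION (not an item; the strategist may not open routes): the dihedral form of
the route's crux `MinimalDatumPFold` — Clay failure at `ν` ⇒ for unboundedly many `p`, a minimal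
blow-up datum equivariant under the rotation by `2π/p` AND under the reflection `reflY`
(dihedral group `D_p`; for `p = 2^k` a 2-group, the natural setting of Smith theory). -/
def MinimalDatumDihedral : Prop :=
  ∀ ν : ℝ, 0 < ν → (∃ v₀ : EuclideanSpace ℝ (Fin 3) → EuclideanSpace ℝ (Fin 3),
    ContDiff ℝ (⊤ : ℕ∞) v₀ ∧ Literature.Analysis.FluidPDE.NSWave0.IsDivFree v₀ ∧
    Literature.Analysis.FluidPDE.HasRapidSpatialDecay v₀ ∧
    ¬ ∃ (u : ℝ → EuclideanSpace ℝ (Fin 3) → EuclideanSpace ℝ (Fin 3))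
        (p : ℝ → EuclideanSpace ℝ (Fin 3) → ℝ),
        Literature.Analysis.FluidPDE.IsSmoothOnHalfSpace u ∧
        Literature.Analysis.FluidPDE.IsSmoothOnHalfSpace p ∧
        Literature.Analysis.FluidPDE.IsNavierStokesSolution ν 0 v₀ u p ∧
        Literature.Analysis.FluidPDE.HasBoundedEnergy u) →
    ∀ N : ℕ, ∃ p : ℕ, N ≤ p ∧ 2 ≤ p ∧
      ∃ (u₀ : EuclideanSpace ℝ (Fin 3) → EuclideanSpace ℝ (Fin 3))
        (g : Literature.Analysis.FunctionSpaces.HomSobolev (EuclideanSpace ℝ (Fin 3))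
          (EuclideanSpace ℂ (Fin 3)) (1 / 2 : ℝ)),
        IsMinimalBlowupDatum ν u₀ g ∧ (∀ x, u₀ (rotZ (2 * Real.pi / p) x) = rotZ (2 * Real.pi / p) (u₀ x)) ∧
        IsReflSymmetric u₀

/-- ROUTE-LEVEL SUGGESTION (not an item): dihedral analogue of the PROVED crux
`PFoldToAxisymmetric` — the same compactness-mod-`Sim` / axis-pinning / dense-angle-closure /
a.e.-upgrade argument, carrying one reflection along. -/
def DihedralToO2 : Prop :=
  ∀ ν : ℝ, 0 < ν → (∀ N : ℕ, ∃ p : ℕ, N ≤ p ∧ 2 ≤ p ∧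
      ∃ (u₀ : EuclideanSpace ℝ (Fin 3) → EuclideanSpace ℝ (Fin 3))
        (g : Literature.Analysis.FunctionSpaces.HomSobolev (EuclideanSpace ℝ (Fin 3))
          (EuclideanSpace ℂ (Fin 3)) (1 / 2 : ℝ)),
        IsMinimalBlowupDatum ν u₀ g ∧ (∀ x, u₀ (rotZ (2 * Real.pi / p) x) = rotZ (2 * Real.pi / p) (u₀ x)) ∧
        IsReflSymmetric u₀) →
    ∃ (u₀ : EuclideanSpace ℝ (Fin 3) → EuclideanSpace ℝ (Fin 3))
      (g : Literature.Analysis.FunctionSpaces.HomSobolev (EuclideanSpace ℝ (Fin 3))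
        (EuclideanSpace ℂ (Fin 3)) (1 / 2 : ℝ)),
      IsMinimalBlowupDatum ν u₀ g ∧ IsAxisymmetric u₀ ∧ IsReflSymmetric u₀

/-- **The dihedral re-glue closes with NO analytic crux**: `MinimalDatumDihedral → DihedralToO2 →
NavierStokesRegularity`, the place of AX_H being taken by the landed no-swirl theorem through
`no_O2_minimalBlowupDatum`. -/
theorem closes_of_dihedral (h₂ : MinimalDatumDihedral) (h₄ : DihedralToO2) :
    NavierStokesRegularity := by
  show Literature.NS.NavierStokesExistenceSmoothR3
  intro ν hν u₀ hsm hdiv hdec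
  by_contra hno
  obtain ⟨u₁, g, hmin, hax, hσ⟩ := h₄ ν hν (h₂ ν hν ⟨u₀, hsm, hdiv, hdec, hno⟩)
  exact no_O2_minimalBlowupDatum ν hν u₁ g hmin hax hσ

/-- … and conversely the summit gives `MinimalDatumDihedral` by vacuity of its antecedent, so the
re-glued route's single open crux is summit-EQUIVALENT given the (routine) `DihedralToO2` — the
re-glue removes AX_H but is not a strategy short of the summit. -/
theorem minimalDatumDihedral_of_summit (hS : NavierStokesRegularity) : MinimalDatumDihedral := by
  intro ν hν hfail
  obtain ⟨v₀, hsm, hdiv, hdec, hno⟩ := hfail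
  exact absurd (hS ν hν v₀ hsm hdiv hdec) hno

/-! ## The "absolute small swirl" rung (census § Decomposition (c)) -/

/-- **Absolute small-swirl global existence** (typed; OPEN in print — the small-swirl theorems of
Lei–Zhang 2017 Thm 1.4 / Chen–Fang–Zhang 2017 Thm 1.2 are RELATIVE: the threshold depends on other
norms of the datum): for every `ν > 0` some `ε > 0` makes every admissible axisymmetric datum with
`sup |Γ₀| ≤ ε ν` global.  `Γ = swirl` is scale-invariant and `Γ ↦ Γ/ν` under `u ↦ ν⁻¹ u`, so
`ε` is dimensionless. -/
def AbsSmallSwirlKatoGlobal : Prop :=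
  ∀ ν : ℝ, 0 < ν → ∃ ε : ℝ, 0 < ε ∧
    ∀ (u₀ : EuclideanSpace ℝ (Fin 3) → EuclideanSpace ℝ (Fin 3))
      (g : Literature.Analysis.FunctionSpaces.HomSobolev (EuclideanSpace ℝ (Fin 3))
        (EuclideanSpace ℂ (Fin 3)) (1 / 2 : ℝ)),
      MemLp u₀ 3 volume → g.Represents (Literature.Analysis.FunctionSpaces.EuclideanSpace.complexify ∘ u₀) →
      IsWeaklyDivFree u₀ → IsAxisymmetric u₀ → (∀ x, |swirl u₀ x| ≤ ε * ν) →
      HasGlobalKatoSolution ν u₀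

/-- The complementary "large swirl" piece that a small/large split would need: it is AX_H
restricted to data with `sup |Γ₀| > ε ν` or `Γ₀ ∉ L^∞` — i.e. AX_H minus a set that is NOT where
the difficulty lives; typed only to make the costume visible. -/
def LargeSwirlKatoGlobal (ε : ℝ) : Prop :=
  ∀ ν : ℝ, 0 < ν →
    ∀ (u₀ : EuclideanSpace ℝ (Fin 3) → EuclideanSpace ℝ (Fin 3))
      (g : Literature.Analysis.FunctionSpaces.HomSobolev (EuclideanSpace ℝ (Fin 3))
        (EuclideanSpace ℂ (Fin 3)) (1 / 2 : ℝ)),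
      MemLp u₀ 3 volume → g.Represents (Literature.Analysis.FunctionSpaces.EuclideanSpace.complexify ∘ u₀) →
      IsWeaklyDivFree u₀ → IsAxisymmetric u₀ → (¬ ∀ x, |swirl u₀ x| ≤ ε * ν) →
      HasGlobalKatoSolution ν u₀

/-- The small/large assembly is trivially valid (excluded middle on `sup |Γ₀| ≤ ε ν`) — which is
exactly why it carries no reduction: the large piece is AX_H on the complement. -/
theorem crux_of_small_large (hs : AbsSmallSwirlKatoGlobal)
    (hl : ∀ ν : ℝ, 0 < ν → ∀ ε : ℝ, 0 < ε → LargeSwirlKatoGlobal ε) : AxisymmetricKatoGlobal := by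
  intro ν hν u₀ g hL3 hrep hdiv hax
  obtain ⟨ε, hε, hsmall⟩ := hs ν hν
  by_cases hΓ : ∀ x, |swirl u₀ x| ≤ ε * ν
  · exact hsmall u₀ g hL3 hrep hdiv (fun θ x => hax θ x) hΓ
  · exact hl ν hν ε hε ν hν u₀ g hL3 hrep hdiv (fun θ x => hax θ x) hΓ

end Summit.NavierStokesRegularity.NavierStokesRegularity.Cruxes.AxisymmetricKatoGlobal.StrategistS20g13

end
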